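import Summits.BirchSwinnertonDyer.Rank1Residual.Additive.X4RankZeroVisibleLowerBoundTransportPotMultFacts
import Summits.BirchSwinnertonDyer.Rank1Residual.X2.ClassClosureEntireFree
import HarnessLib

/-!
# X4 ∧ `r = 0`, (M) rows: the hvis-currency END and the TRANSPORT-currency record socket WITHOUT the
# modularity binder `hmod : hasEntireLFunction_rat` (A19) — twins of FILE 4 with `hmod` DERIVED in-file
# from the parametrisation datum `hmodD : nonempty_modularParametrizationData` they already display
# (cell `b2b-bsdres`, team n1011; ROW T-VIS3-TATE-REC FILE 4b, seat p14 GEN 7; TOOL file)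

HONEST FRAMING (cell `b2b-bsdres`, run/shared/lean/b2b/bsd-rank1-residual/, verbatim in every
file): the goal of the cell is to DELETE the COMBINATION-SHAPED residual classes of the
Birch–Swinnerton-Dyer formula for ALL analytic-rank `≤ 1` elliptic curves over `ℚ` — "full BSD
formula for every rank `≤ 1` curve in class `C`" assembled STRICTLY from published theorems — so
that the rank-`≤ 1` remainder becomes exactly the CONSTRUCTION-SHAPED classes, which are TYPED
(missing-input `Prop`s), NOT attempted. This is not "finishing BSD". Team n1011 (N11 = X4 ∧ `p = 3`):
research route on the CONSTRUCTION-SHAPED class X4; TOOL theorems only (no definition, no new named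
fact, no `sorry`); CONDITIONAL on the named facts displayed as hypotheses — here FOUR UPPER-half
facts of the (M)-END of record (`hDel` A75, `hGZK`, `hmodD`, `hKatoχ` W14) plus Cassels–Tate `hCT`;
closes NO class and NO row by itself; a record over these sockets closes NOTHING beyond its displayed
binders; nothing booked; no mark / label / count moved.

## Why

FILE 4 (`X4RankZeroVisibleLowerBoundTransportPotMultFacts.lean`, p325562) displays BOTH
`hmod : hasEntireLFunction_rat` (A19: `L(E, s)` entire) AND `hmodD : nonempty_modularParametrizationData`
(BCDT: a modular parametrisation datum for every globally minimal `E/ℚ`).  The first FOLLOWS from the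
second by a theorem of the tree — the X2 cell's
`X2.ClassClosureEntireFree.hasEntireLFunction_rat_of_nonempty_modularParametrizationData`
(`b2b-bsdres-eisenstein-p2`, `Summits/…/X2/ClassClosureEntireFree.lean` §1: a datum for the minimal
model gives the newform of `E`, BCDT p. 845 (6) ⇒ (2), then Diamond–Shurman Thm. 5.10.2 / 8.8.3),
consumed here BY NAME — the same bridge n1011-p10's ROW T-ENTFREE (`Additive/EndsOfRecordEntireFree.lean`)
applies to the class ENDs of record.  This file re-keys the two T-VIS3-TATE sockets of FILE 4 on the
strict sub-list, binder diff EXACTLY {−`hmod`}, NOTHING added, conclusions and every other binder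
identical; the proofs are ONE call of FILE 4 each.  Records `bsdp3_visT_v<E>` already landed over FILE 3 /
FILE 4 inherit the shorter list without re-filing (route 2's ledger note (E)); nothing is re-filed.

* `X4RankZero.bsdp_three_potMult_of_exists_sha_three_torsion_entireFree` — hvis currency;
* `X4RankZero.bsdp_three_potMult_of_congr_of_transport_of_primeList_entireFree` — transport currency
  (per place `ι_v(θ) = 1`, any kind; NO paid place; budget `1 < 3^{rank E′}`).

What is NOT claimed: A19 stays a registered fact of the Literature; no row closes; n1011-p10's END
`X4RankZero.bsdp_three_potMult_of_selmerGroup_ne_bot_potMultFacts` is consumed UNCHANGED (its own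
`hmod` binder is fed the derived term).

References: [CremonaMazur2000] §3; [AgasheStein2002] Thm. 3.1, §3.5; [Delbourgo1998] Prop. 4;
[BCDTJAMS2001] Thm. A; [DiamondShurman2005] Thm. 5.10.2, 8.8.3; [SilvermanAEC2009] X.4.2 (a);
[MilneADT2006] I.3.3; [Wuthrich2014] §9.
-/

set_option autoImplicit false

noncomputable section

open scoped Classical NumberField
open IsDedekindDomain NumberField WeierstrassCurve Rat.HeightOneSpectrum
  Literature.NumberTheory.EllipticCurves Literature.NumberTheory.EllipticCurves.ModularForms
  Literature.NumberTheory.EllipticCurves.Rank1Residual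
  Literature.NumberTheory.EllipticCurves.Rank1Residual.Typed
  Literature.NumberTheory.GaloisRepresentations
  Summit.BirchSwinnertonDyer.Rank1Residual.GaloisImage

namespace Summit.BirchSwinnertonDyer.Rank1Residual.Additive

/-- **(M)-row END in hvis currency WITHOUT `hmod`**: for `W/ℚ` globally minimal with `r_an = 0`, X4 at `3`,
`ρ̄_{E,3}` onto, `ord₃ j < 0`, `ord₃ #Ш_an ≤ 2`, a visible element `c ∈ Ш(E)[3] ∖ 0` gives `BSD(E,3)` —
conditional on Delbourgo's Prop. 4 (`hDel`), GZK (`hGZK`), a modular parametrisation datum (`hmodD`),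
Wuthrich's half-eigen-character divisibility (`hKatoχ`) and Cassels–Tate (`hCT`); FILE 4's
`…_exists_sha_three_torsion_potMultFacts` with `hmod` derived from `hmodD` by the X2 cell's bridge.
[cite: CremonaMazur2000, §3] [cite: Delbourgo1998, Prop. 4 (p. 144)] [cite: Wuthrich2014, §9 Thm. 21]
[cite: BCDTJAMS2001, Thm. A] [cite: DiamondShurman2005, Thm. 5.10.2] -/
theorem X4RankZero.bsdp_three_potMult_of_exists_sha_three_torsion_entireFree
    (hDel : Delbourgo1998.prop4_rankZero_pow_dvd_constantCoeff)
    (hGZK : rank_eq_analyticRank_of_analyticRank_le_one)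
    (hmodD : nonempty_modularParametrizationData)
    (hKatoχ : Wuthrich2014.kato_halfEigenCharIdeal_dvd_cyclotomicPrime_of_surjective)
    (hCT : exists_casselsTate_pairing (K := ℚ))
    (W : WeierstrassCurve ℚ) [W.IsElliptic] [W.IsGloballyMinimal] (hr : W.analyticRank = 0)
    (hX : haveI : Fact (Nat.Prime 3) := ⟨Nat.prime_three⟩; ClassX4 W 3)
    (hsurj : W.HasSurjectiveModNGaloisRep 3) (hj : padicValRat 3 W.j < 0)
    {q : ℚ} (hq : shaAn W = (q : ℂ)) (hv : padicValRat 3 q ≤ 2)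
    (hvis : ∃ c : W.sha, c ≠ 0 ∧ (3 : ℕ) • c = 0) :
    haveI : Fact (Nat.Prime 3) := ⟨Nat.prime_three⟩
    BSDp W 3 :=
  X4RankZero.bsdp_three_potMult_of_exists_sha_three_torsion_potMultFacts hDel hGZK
    (X2.ClassClosureEntireFree.hasEntireLFunction_rat_of_nonempty_modularParametrizationData hmodD)
    hmodD hKatoχ hCT W hr hX hsurj hj hq hv hvis

/-- **The T-VIS3-TATE record socket in TRANSPORT currency WITHOUT `hmod`** ((M) rows): as FILE 4's
`X4RankZero.bsdp_three_potMult_of_congr_of_transport_of_primeList_potMultFacts` — `E′` `3`-congruent to `E`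
via `θ`, `rank E′ ≥ 1`, integer models `E₀`, `F₀`, a prime list `L ∋ 3` supporting both discriminants,
and at every place over `L` the transport `ι_v(θ) = 1` (any kind) — with the named-fact list of the hvis
END above (`hmod` derived from `hmodD`, not displayed).
[cite: CremonaMazur2000, §3 and Table 1] [cite: AgasheStein2002, Thm. 3.1 and §3.5] [cite: SilvermanAEC2009, Thm. X.4.2 (a)]
[cite: BCDTJAMS2001, Thm. A] [cite: DiamondShurman2005, Thm. 5.10.2] -/
theorem X4RankZero.bsdp_three_potMult_of_congr_of_transport_of_primeList_entireFree
    (hDel : Delbourgo1998.prop4_rankZero_pow_dvd_constantCoeff)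
    (hGZK : rank_eq_analyticRank_of_analyticRank_le_one)
    (hmodD : nonempty_modularParametrizationData)
    (hKatoχ : Wuthrich2014.kato_halfEigenCharIdeal_dvd_cyclotomicPrime_of_surjective)
    (hCT : exists_casselsTate_pairing (K := ℚ))
    (W : WeierstrassCurve ℚ) [W.IsElliptic] [W.IsGloballyMinimal] (hr : W.analyticRank = 0)
    (hX : haveI : Fact (Nat.Prime 3) := ⟨Nat.prime_three⟩; ClassX4 W 3)
    (hsurj : W.HasSurjectiveModNGaloisRep 3) (hj : padicValRat 3 W.j < 0)
    {q : ℚ} (hq : shaAn W = (q : ℂ)) (hv : padicValRat 3 q ≤ 2)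
    (W' : WeierstrassCurve ℚ) [W'.IsElliptic]
    (θ : geomTorsion W' ((3 : ℕ) : ℤ) ≃+ geomTorsion W ((3 : ℕ) : ℤ))
    (hθ : ∀ (σ : Field.absoluteGaloisGroup ℚ) (P : geomTorsion W' ((3 : ℕ) : ℤ)),
      θ (σ • P) = σ • θ P)
    (hrank : 1 ≤ W'.mordellWeilRank)
    {E₀ F₀ : WeierstrassCurve ℤ} (hE : E₀.map (Int.castRingHom ℚ) = W)
    (hF : F₀.map (Int.castRingHom ℚ) = W') (L : List ℕ) (h3L : 3 ∈ L)
    (hΔE : ∀ q : ℕ, q.Prime → (q : ℤ) ∣ E₀.Δ → q ∈ L)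
    (hΔF : ∀ q : ℕ, q.Prime → (q : ℤ) ∣ F₀.Δ → q ∈ L)
    (htrans : ∀ w : HeightOneSpectrum (𝓞 ℚ), (primesEquiv w : ℕ) ∈ L →
      (selmerLocalKer W (w.adicCompletion ℚ) ((3 : ℕ) : ℤ)).relIndex
        ((selmerLocalKer W' (w.adicCompletion ℚ) ((3 : ℕ) : ℤ)).map (h1Equiv θ hθ).toAddMonoidHom) = 1) :
    haveI : Fact (Nat.Prime 3) := ⟨Nat.prime_three⟩
    BSDp W 3 :=
  X4RankZero.bsdp_three_potMult_of_congr_of_transport_of_primeList_potMultFacts hDel hGZK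
    (X2.ClassClosureEntireFree.hasEntireLFunction_rat_of_nonempty_modularParametrizationData hmodD)
    hmodD hKatoχ hCT W hr hX hsurj hj hq hv W' θ hθ hrank hE hF L h3L hΔE hΔF htrans

end Summit.BirchSwinnertonDyer.Rank1Residual.Additive

end
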